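import Summits.CriticalPhenomena.PercolationContinuityZ3.Theorems.PercNearOneGluingAdditiveGluingTwoStepGlueTools
import HarnessLib

/-!
# Crux `PercNearOneGluing.AdditiveGluing` (stmt-CriticalPhenomena-4576), line `tieline`: the spectator-edge BHK
# inequality F1 (registered stub `stub_spectatorEdgeBHK_c9`)

Support file (`--supports stmt-CriticalPhenomena-4576`, lead c9, skeleton v18).  No definitions, no named facts, no sorries.

Weighted graph on `Fin n` (`μ = prodBernoulli w`), pair `A = {u, v}` to be glued, spectator `c`, observer `o`, and a pair
`e = s(c, y)` at the spectator (`c ≠ y`).  With `N = {c ↮ u} ∩ {c ↮ v}` and `O_A = {o ↔ u} ∪ {o ↔ v}`: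

**F1 (`stub_spectatorEdgeBHK_c9`).**  `μ(N) · μ(N ∩ {e open} ∩ O_A) ≤ μ(N ∩ {e open}) · μ(N ∩ O_A)`,
i.e. opening `e` does not increase `Φ = μ(o ↔ A | c ↮ A)`.

Proof.  In the graph where the pair `{u, v}` is glued (`μ¹ = μ_{w[s(u,v) ↦ 1]}`, the pushforward of `μ` under
`ω ↦ ω ∪ {s(u,v)}`, `fullTie_real_update_one`), given `D = {c ↮ u}` the indicator of `{e ∈ C_c}` is an increasing
function of the open edge cluster `C_c` of `c` (and, `e` being incident to `c`, `e ∈ C_c ↔ e open`), while `{o ∈ C_u}`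
is increasing in the edge cluster of `u`; by van den Berg–Häggström–Kahn's Theorem 1.4 (two clusters are negatively
correlated given their separation; Kozma–Nitzan §2.2) `μ¹(D)·μ¹(D ∩ {e open} ∩ {o↔u}) ≤ μ¹(D ∩ {e open})·μ¹(D ∩ {o↔u})`.
Pulling the four probabilities back along the gluing (`fullTie_glueReach_pair`) gives F1: `D ↦ N`, `{o↔u} ↦ O_A`,
`{e open} ↦ {e open}` (`e` is not the glued pair since `c ∉ {u, v}`).  Degenerate cases `c ∈ {u, v}` (then `N = ∅`) and
`u = v` (no gluing) are immediate.
[cite: VandenbergHaggstromKahn2005, Thm. 1.4 (p. 7)] [cite: KozmaNitzan2024, §2.2 (p. 5), the BHK inequality for two clusters]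
-/

namespace Summit.CriticalPhenomena.PercolationContinuityZ3.Theorems

open MeasureTheory Set Literature.Probability.LatticeModels Literature.Probability.Percolation
open scoped Classical

noncomputable section

namespace SpectatorEdgeBHK

variable {V : Type*}

/-- A non-diagonal pair at `c` lies in the open edge cluster of `c` iff it is open. [folklore] -/
theorem mk_mem_openEdgeCluster_iff (ω : BondConfig V) {c y : V} (hcy : c ≠ y) :
    s(c, y) ∈ openEdgeCluster ω c ↔ s(c, y) ∈ ω := by
  rw [mem_openEdgeCluster_iff]
  constructor
  · exact fun h => h.1
  · intro h
    refine ⟨h, fun hd => hcy (Sym2.mk_isDiag_iff.1 hd), fun v hv => ?_⟩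
    rcases Sym2.mem_iff.1 hv with rfl | rfl
    · exact SimpleGraph.Reachable.refl _
    · exact SimpleGraph.Adj.reachable ((openGraph_adj ω _ _).2 ⟨h, hcy⟩)

/-- Event form: `{C_c ∋ s(c,y)} = {s(c,y) open}` for `c ≠ y`. [folklore] -/
theorem setOf_openEdgeCluster_mem_eq {c y : V} (hcy : c ≠ y) :
    {ω : BondConfig V | openEdgeCluster ω c ∈ {C : Set (Sym2 V) | s(c, y) ∈ C}} =
      {ω : BondConfig V | s(c, y) ∈ ω} := by
  ext ω
  exact mk_mem_openEdgeCluster_iff ω hcy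

/-- `{c ↮ c} = ∅`. [folklore] -/
theorem compl_openConn_self (c : V) : ((openConn c c)ᶜ : Set (BondConfig V)) = ∅ := by
  ext ω
  simp only [mem_compl_iff, mem_empty_iff_false, iff_false, not_not]
  exact SimpleGraph.Reachable.refl _

variable [Fintype V]

/-- **BHK Thm. 1.4 for the edge event at `c` and the connection event at `u`, given `{c ↮ u}`** (`c ≠ u`, `c ≠ y`):
`μ(c↮u) · μ({c↮u} ∩ ({s(c,y) open} ∩ {o↔u})) ≤ μ({c↮u} ∩ {s(c,y) open}) · μ({c↮u} ∩ {o↔u})`.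
[cite: VandenbergHaggstromKahn2005, Thm. 1.4 (p. 7)] [cite: KozmaNitzan2024, §2.2 (p. 5)] -/
theorem bhk_edge_conn (w : Sym2 V → unitInterval) (o c u y : V) (hcu : c ≠ u) (hcy : c ≠ y) :
    (prodBernoulli w).real ((openConn c u)ᶜ : Set (BondConfig V)) *
        (prodBernoulli w).real ((openConn c u)ᶜ ∩ ({ω : BondConfig V | s(c, y) ∈ ω} ∩ openConn o u)) ≤
      (prodBernoulli w).real ((openConn c u)ᶜ ∩ {ω : BondConfig V | s(c, y) ∈ ω}) *
        (prodBernoulli w).real ((openConn c u)ᶜ ∩ openConn o u) := by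
  have h𝒜 : IsUpperSet {C : Set (Sym2 V) | s(c, y) ∈ C} := fun _ _ hCC' h => hCC' h
  have key := KNPreFKG.bhk_two_upper_upper w c u hcu h𝒜 (KNPreFKG.isUpperSet_connFamily u o)
  rw [setOf_openEdgeCluster_mem_eq hcy, ← KNPreFKG.openConn_eq_setOf_connFamily, KNPreFKG.openConn_symm u o] at key
  have hD : {ω : BondConfig V | ¬ (openGraph ω).Reachable c u} = (openConn c u)ᶜ := by
    ext ω
    simp only [mem_setOf_eq, mem_compl_iff, openConn]
  rw [hD] at key
  exact key

end SpectatorEdgeBHK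

namespace SpectatorEdgeBHK

variable {n : ℕ}

/-- A pair containing the spectator `c ∉ {u, v}` is not added by gluing `{u, v}`. [folklore] -/
theorem mk_mem_union_glue_iff (ω : BondConfig (Fin n)) {u v c : Fin n} (y : Fin n) (hcu : c ≠ u) (hcv : c ≠ v) :
    s(c, y) ∈ (ω ∪ {e | (∀ z ∈ e, z ∈ ({u, v} : Finset (Fin n))) ∧ ¬ e.IsDiag}) ↔ s(c, y) ∈ ω := by
  rw [Set.mem_union, Set.mem_setOf_eq]
  constructor
  · rintro (h | ⟨h, -⟩)
    · exact h
    · have hc := h c (Sym2.mem_mk_left c y)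
      simp only [Finset.mem_insert, Finset.mem_singleton] at hc
      exact absurd hc (not_or.2 ⟨hcu, hcv⟩)
  · exact fun h => Or.inl h

/-- Pull-back of `{c ↮ u}` along the gluing of `{u, v}`: `μ¹(c ↮ u) = μ({c↮u} ∩ {c↮v})`. [folklore] -/
theorem glue_real_N (w : Sym2 (Fin n) → unitInterval) {u v : Fin n} (huv : u ≠ v) (c : Fin n) :
    (prodBernoulli (Function.update w s(u, v) 1)).real ((openConn c u)ᶜ : Set (BondConfig (Fin n))) =
      (prodBernoulli w).real ((openConn c u)ᶜ ∩ (openConn c v)ᶜ : Set (BondConfig (Fin n))) := by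
  rw [fullTie_real_update_one w huv]
  congr 1
  ext ω
  simp only [Set.mem_setOf_eq, Set.mem_inter_iff, Set.mem_compl_iff]
  rw [fullTie_glueReach_pair]
  have h11 := fullTie_mem_openConn_self u ω
  tauto

/-- Pull-back of `{c ↮ u} ∩ {s(c,y) open}`: `μ¹ = μ({c↮u} ∩ {c↮v} ∩ {s(c,y) open})` (`c ∉ {u, v}`). [folklore] -/
theorem glue_real_NE (w : Sym2 (Fin n) → unitInterval) {u v c : Fin n} (huv : u ≠ v) (hcu : c ≠ u) (hcv : c ≠ v)
    (y : Fin n) :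
    (prodBernoulli (Function.update w s(u, v) 1)).real
        ((openConn c u)ᶜ ∩ {ω : BondConfig (Fin n) | s(c, y) ∈ ω}) =
      (prodBernoulli w).real
        ((openConn c u)ᶜ ∩ (openConn c v)ᶜ ∩ {ω : BondConfig (Fin n) | s(c, y) ∈ ω}) := by
  rw [fullTie_real_update_one w huv]
  congr 1
  ext ω
  simp only [Set.mem_setOf_eq, Set.mem_inter_iff, Set.mem_compl_iff]
  rw [mk_mem_union_glue_iff ω y hcu hcv, fullTie_glueReach_pair]
  have h11 := fullTie_mem_openConn_self u ω
  tauto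

/-- Pull-back of `{c ↮ u} ∩ {o ↔ u}`: `μ¹ = μ({c↮u} ∩ {c↮v} ∩ ({o↔u} ∪ {o↔v}))`. [folklore] -/
theorem glue_real_NO (w : Sym2 (Fin n) → unitInterval) {u v : Fin n} (huv : u ≠ v) (o c : Fin n) :
    (prodBernoulli (Function.update w s(u, v) 1)).real ((openConn c u)ᶜ ∩ openConn o u) =
      (prodBernoulli w).real
        ((openConn c u)ᶜ ∩ (openConn c v)ᶜ ∩ (openConn o u ∪ openConn o v) : Set (BondConfig (Fin n))) := by
  rw [fullTie_real_update_one w huv]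
  congr 1
  ext ω
  simp only [Set.mem_setOf_eq, Set.mem_inter_iff, Set.mem_compl_iff]
  rw [fullTie_glueReach_pair, fullTie_glueReach_pair, Set.mem_union]
  have h11 := fullTie_mem_openConn_self u ω
  tauto

/-- Pull-back of `{c ↮ u} ∩ ({s(c,y) open} ∩ {o ↔ u})`:
`μ¹ = μ({c↮u} ∩ {c↮v} ∩ {s(c,y) open} ∩ ({o↔u} ∪ {o↔v}))` (`c ∉ {u, v}`). [folklore] -/
theorem glue_real_NEO (w : Sym2 (Fin n) → unitInterval) {u v c : Fin n} (huv : u ≠ v) (hcu : c ≠ u) (hcv : c ≠ v)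
    (o y : Fin n) :
    (prodBernoulli (Function.update w s(u, v) 1)).real
        ((openConn c u)ᶜ ∩ ({ω : BondConfig (Fin n) | s(c, y) ∈ ω} ∩ openConn o u)) =
      (prodBernoulli w).real
        ((openConn c u)ᶜ ∩ (openConn c v)ᶜ ∩ {ω : BondConfig (Fin n) | s(c, y) ∈ ω} ∩
          (openConn o u ∪ openConn o v)) := by
  rw [fullTie_real_update_one w huv]
  congr 1
  ext ω
  simp only [Set.mem_setOf_eq, Set.mem_inter_iff, Set.mem_compl_iff]
  rw [mk_mem_union_glue_iff ω y hcu hcv, fullTie_glueReach_pair, fullTie_glueReach_pair, Set.mem_union]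
  have h11 := fullTie_mem_openConn_self u ω
  tauto

/-- **F1, main case** (`u ≠ v`, `c ∉ {u, v}`, `c ≠ y`): BHK Thm. 1.4 in the graph with `{u, v}` glued, pulled back.
[cite: VandenbergHaggstromKahn2005, Thm. 1.4 (p. 7)] [cite: KozmaNitzan2024, §2.2 (p. 5)] -/
theorem spectatorEdgeBHK_glued (w : Sym2 (Fin n) → unitInterval) (o : Fin n) {u v c y : Fin n} (huv : u ≠ v)
    (hcu : c ≠ u) (hcv : c ≠ v) (hcy : c ≠ y) :
    (prodBernoulli w).real ((openConn c u)ᶜ ∩ (openConn c v)ᶜ : Set (BondConfig (Fin n))) *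
        (prodBernoulli w).real ((openConn c u)ᶜ ∩ (openConn c v)ᶜ ∩ {ω : BondConfig (Fin n) | s(c, y) ∈ ω} ∩
          (openConn o u ∪ openConn o v)) ≤
      (prodBernoulli w).real ((openConn c u)ᶜ ∩ (openConn c v)ᶜ ∩ {ω : BondConfig (Fin n) | s(c, y) ∈ ω}) *
        (prodBernoulli w).real ((openConn c u)ᶜ ∩ (openConn c v)ᶜ ∩ (openConn o u ∪ openConn o v)) := by
  have key := bhk_edge_conn (Function.update w s(u, v) 1) o c u y hcu hcy
  rw [glue_real_N w huv c, glue_real_NE w huv hcu hcv y, glue_real_NO w huv o c,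
    glue_real_NEO w huv hcu hcv o y] at key
  exact key

end SpectatorEdgeBHK

open SpectatorEdgeBHK in
/-- **Registered stub `stub_spectatorEdgeBHK_c9`** (F1, spectator-edge BHK; line `tieline`, crux `AdditiveGluing`): for the
pair `e = s(c,y)` at the spectator, `Φ = μ(o↔A | c↮A)` does not increase when `e` is opened:
`μ(N)·μ(N ∩ {e open} ∩ O_A) ≤ μ(N ∩ {e open})·μ(N ∩ O_A)`, `N = {c↮u} ∩ {c↮v}`, `O_A = {o↔u} ∪ {o↔v}`.
vdBHK Thm. 1.4 given `{c ↮ A}` in `G/{u,v}` with `f = 1{e ∈ C_c}`, `g = 1{o ∈ C_u}`; degenerate cases `c ∈ {u,v}`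
(`N = ∅`) and `u = v` (no gluing) directly.
[cite: VandenbergHaggstromKahn2005, Thm. 1.4 (p. 7)] [cite: KozmaNitzan2024, §2.2 (p. 5)] -/
theorem stub_spectatorEdgeBHK_c9 : ∀ (n : ℕ) (w : Sym2 (Fin n) → unitInterval) (o u v c y : Fin n), c ≠ y →
    (Literature.Probability.LatticeModels.prodBernoulli w).real
          ((Literature.Probability.Percolation.openConn c u)ᶜ ∩ (Literature.Probability.Percolation.openConn c v)ᶜ :
            Set (Literature.Probability.Percolation.BondConfig (Fin n))) *
        (Literature.Probability.LatticeModels.prodBernoulli w).real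
          ((Literature.Probability.Percolation.openConn c u)ᶜ ∩ (Literature.Probability.Percolation.openConn c v)ᶜ ∩
            {ω : Literature.Probability.Percolation.BondConfig (Fin n) | s(c, y) ∈ ω} ∩
            (Literature.Probability.Percolation.openConn o u ∪ Literature.Probability.Percolation.openConn o v)) ≤
      (Literature.Probability.LatticeModels.prodBernoulli w).real
          ((Literature.Probability.Percolation.openConn c u)ᶜ ∩ (Literature.Probability.Percolation.openConn c v)ᶜ ∩
            {ω : Literature.Probability.Percolation.BondConfig (Fin n) | s(c, y) ∈ ω}) *
        (Literature.Probability.LatticeModels.prodBernoulli w).real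
          ((Literature.Probability.Percolation.openConn c u)ᶜ ∩ (Literature.Probability.Percolation.openConn c v)ᶜ ∩
            (Literature.Probability.Percolation.openConn o u ∪ Literature.Probability.Percolation.openConn o v)) := by
  intro n w o u v c y hcy
  by_cases hcu : c = u
  · rw [← hcu, compl_openConn_self c]
    simp only [Set.empty_inter, measureReal_empty, mul_zero, le_refl]
  by_cases hcv : c = v
  · rw [← hcv, compl_openConn_self c]
    simp only [Set.inter_empty, Set.empty_inter, measureReal_empty, mul_zero, le_refl]
  by_cases huv : u = v
  · rw [← huv, Set.inter_self, Set.union_self]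
    have key := bhk_edge_conn w o c u y hcu hcy
    rw [← Set.inter_assoc] at key
    exact key
  · exact spectatorEdgeBHK_glued w o huv hcu hcv hcy

end

end Summit.CriticalPhenomena.PercolationContinuityZ3.Theorems
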